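import Literature.Probability.LatticeModels.GoodCrossingCaseI
import Literature.Probability.LatticeModels.InterfaceTouching
import Literature.Probability.Percolation.HalfAnnulusDuality
import HarnessLib

/-!
# The good crossing above the box when one colour is absent (GH2000, Lemma 5.5, Cases 1–2)

Topic `Probability/LatticeModels`. Georgii–Higuchi 2000, proof of Lemma 5.5 (p. 1161):
"*Case 1: `μ(E⁺_up) = 0`.* … `π_up` then almost surely contains an infinite `-`cluster `I⁻_up`,
and each finite subset of `π_up` is surrounded by a `-∗`semicircuit in `π_up`. In other words, an
infinite `-∗`cluster `I^{-∗}_up` in `π_up` exists and touches both `ℓ_left` and `ℓ_right` infinitely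
often. By the pinning lemma and the positive correlations of `μ`, with `μ`-probability at least
`(θ/4)²` both `x` and `y` are `-∗`connected to `I^{-∗}_up` outside `Δ`, and therefore also
`-∗`connected to each other by a `-∗`path `p` above `Δ`. However, this `-∗`path `p` on the first
layer is certainly also a `≤∗`path for the duplicated system, and the claim follows.
*Case 2: `μ(E⁻_up) = 0`.* … Interchanging `+` and `-` and replacing `μ` by `μ̂` in Case 1, … there
exists a `+∗`path `p̂` in the second layer above `Δ` from `x` to `y`."

We formalise both cases for a tail-trivial `μ ∈ 𝒢(β, 0)`, `β > β_c`, with an infinite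
`s`-cluster but no infinite `(-s)`-cluster in `π_up` (the existence of the `s`-cluster is what the
application provides; in the paper it comes from Lemma 4.3), taking the pinning lemma as a
hypothesis in the form "pinned off `Δ = Λ_m` to an infinite `∗`-component of the `s`-sites of
`π_up ∖ Λ_m`":

* `ae_starSemicircuits_of_latticeClusters_finite` — "`-∗`semicircuits around every box" from the
  absence of `(-s)`-lattice percolation (`exists_starSemicircuit_or_latticeEscape`);
* `support_subset_siteCluster_of_starSemicircuit` — an infinite `s∗`-cluster of `π_up` (or of
  `π_up ∖ Λ_m`) through a box swallows every `s∗`semicircuit around the box (band lemma with the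
  lattice refinement of a `∗`-walk); hence **two-sidedness** and **uniqueness off the box** of the
  infinite `s∗`-clusters (`ae_singleSign_structure`);
* `le_measureReal_starWalk_of_pins` — FKG for the two pins in one layer and the `s∗`walk from `x`
  to `y` through the unique infinite component;
* `upperGoodCrossing_bound_of_singleSign_minus/plus` — the claim of Lemma 5.5 in Cases 1/2 for the
  duplicated system `μ ⊗ (μ ∘ θ_{s e₁}⁻¹)`, in the form consumed by
  `AizenmanHiguchiFromCrossings.lean`.

## References

* H.-O. Georgii, Y. Higuchi, *Percolation and number of phases in the two-dimensional Ising
  model*, J. Math. Phys. 41 (2000), Lemma 5.5 (proof, Cases 1–2), Lemma 5.2, Lemma 4.1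
  [GeorgiiHiguchi2000].
-/

noncomputable section

open MeasureTheory Filter SimpleGraph
open Literature.Probability.Percolation
open scoped ENNReal

namespace Literature.Probability.LatticeModels

variable {β : ℝ}

/-! ### Measurability and monotonicity of the pinning events -/

section Events

/-- The pinning event "`x` is joined by an `s∗`walk with `Q` to an infinite `∗`-component of
`S^s ∩ P`" is measurable. [folklore] -/
theorem measurableSet_starPin (s : ℤˣ) (P : Set (Site 2)) (x : Site 2) (Q : Site 2 → Prop) :
    MeasurableSet {ω : SpinConfig (Site 2) | ∃ z, (siteCluster zdStarGraph (spinSites s ω ∩ P) z).Infinite ∧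
      ∃ w : zdStarGraph.Walk x z, ∀ v ∈ w.support, ω v = s ∧ Q v} := by
  classical
  have hmeas : Measurable fun ω : SpinConfig (Site 2) => spinSites s ω ∩ P := by
    have h := measurable_spinSites_inter_diff (V := Site 2) s P ∅
    simp only [Finset.coe_empty, Set.sdiff_empty] at h
    exact h.mono cylinderEvents_le_pi le_rfl
  have : {ω : SpinConfig (Site 2) | ∃ z, (siteCluster zdStarGraph (spinSites s ω ∩ P) z).Infinite ∧
      ∃ w : zdStarGraph.Walk x z, ∀ v ∈ w.support, ω v = s ∧ Q v} =
      ⋃ z : Site 2, {ω | (siteCluster zdStarGraph (spinSites s ω ∩ P) z).Infinite} ∩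
        {ω | ∃ w : zdStarGraph.Walk x z, ∀ v ∈ w.support, ω v = s ∧ Q v} := by
    ext ω; simp only [Set.mem_setOf_eq, Set.mem_iUnion, Set.mem_inter_iff]
  rw [this]
  exact MeasurableSet.iUnion fun z =>
    (hmeas (measurableSet_sitePercolatesAt (G := zdStarGraph) z)).inter (measurableSet_exists_spinWalk s x z Q)

/-- The `+∗`pinning event is increasing. [folklore] -/
theorem isUpperSet_starPin_one (P : Set (Site 2)) (x : Site 2) (Q : Site 2 → Prop) :
    IsUpperSet {ω : SpinConfig (Site 2) | ∃ z, (siteCluster zdStarGraph (spinSites 1 ω ∩ P) z).Infinite ∧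
      ∃ w : zdStarGraph.Walk x z, ∀ v ∈ w.support, ω v = 1 ∧ Q v} := by
  rintro ω ω' hle ⟨z, hz, w, hw⟩
  have hup : ∀ v, ω v = 1 → ω' v = 1 := fun v hv =>
    le_antisymm (intUnits_le_one _) (by rw [← hv]; exact hle v)
  have hsub : spinSites 1 ω ∩ P ⊆ spinSites 1 ω' ∩ P := fun v hv => ⟨hup v hv.1, hv.2⟩
  exact ⟨z, hz.mono (siteCluster_mono hsub z), w, fun v hv => ⟨hup v (hw v hv).1, (hw v hv).2⟩⟩

/-- The `-∗`pinning event is decreasing. [folklore] -/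
theorem isLowerSet_starPin_neg_one (P : Set (Site 2)) (x : Site 2) (Q : Site 2 → Prop) :
    IsLowerSet {ω : SpinConfig (Site 2) | ∃ z, (siteCluster zdStarGraph (spinSites (-1) ω ∩ P) z).Infinite ∧
      ∃ w : zdStarGraph.Walk x z, ∀ v ∈ w.support, ω v = -1 ∧ Q v} := by
  rintro ω ω' hle ⟨z, hz, w, hw⟩
  have hdown : ∀ v, ω v = -1 → ω' v = -1 := fun v hv =>
    le_antisymm (by rw [← hv]; exact hle v) (neg_one_le_intUnits _)
  have hsub : spinSites (-1) ω ∩ P ⊆ spinSites (-1) ω' ∩ P := fun v hv => ⟨hdown v hv.1, hv.2⟩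
  exact ⟨z, hz.mono (siteCluster_mono hsub z), w, fun v hv => ⟨hdown v (hw v hv).1, (hw v hv).2⟩⟩

/-- **FKG for two increasing events** under a tail-trivial `μ ∈ 𝒢(β, h)`, `β ≥ 0` (from the
finite-family version `prod_measureReal_le_measureReal_iInter_of_isUpperSet`). [cite: GeorgiiHiguchi2000, §2 p. 4 ("positive correlations")] -/
theorem measureReal_inter_ge_mul_of_isUpperSet {d : ℕ} {h : ℝ} (hβ : 0 ≤ β) {μ : Measure (SpinConfig (Site d))}
    (hμ : μ ∈ isingGibbsMeasures d β h) (hμt : IsTailTrivial μ) {D E : Set (SpinConfig (Site d))}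
    (hD : IsUpperSet D) (hE : IsUpperSet E) (hDm : MeasurableSet D) (hEm : MeasurableSet E) :
    μ.real D * μ.real E ≤ μ.real (D ∩ E) := by
  have key := prod_measureReal_le_measureReal_iInter_of_isUpperSet hβ hμ hμt (Finset.univ : Finset Bool)
    (U := fun b => if b then D else E) (fun b => by cases b <;> simpa) (fun b => by cases b <;> simpa)
  have h1 : (∏ b ∈ (Finset.univ : Finset Bool), μ.real ((fun b => if b then D else E) b)) = μ.real D * μ.real E := by
    rw [Fintype.prod_bool]; simp
  have h2 : (⋂ b ∈ (Finset.univ : Finset Bool), (fun b => if b then D else E) b) = D ∩ E := by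
    ext ω; simp [and_comm]
  rw [h1, h2] at key
  exact key

end Events

/-! ### Semicircuits swallowed by infinite `∗`-clusters -/

section Geometry

variable {ω : SpinConfig (Site 2)} {s : ℤˣ}

/-- **An infinite `s∗`-cluster through the box swallows the `s∗`semicircuits around the box**: if
`σ` is an `s∗`walk of `P`-sites, `P ⊆ π_up`, outside `Λ_n` from `(a, 0)`, `a < -n`, to `(b, 0)`,
`b > n`, and `K` is an infinite `∗`-cluster of `S^s ∩ P` with a site in `Λ_n`, then `σ ⊆ K`
(band lemma for the lattice refinement of a `∗`-walk of `K` leaving a large box). [cite: GeorgiiHiguchi2000, Lemma 4.1 (proof, "Uniqueness") and Lemma 5.5 (Case 1)] -/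
theorem support_subset_siteCluster_of_starSemicircuit {P : Set (Site 2)} (hP : P ⊆ halfPlane 0)
    {n : ℕ} {a b : ℤ} (ha : a < -(n : ℤ)) (hb : (n : ℤ) < b)
    (σ : zdStarGraph.Walk (![a, 0] : Site 2) ![b, 0])
    (hσ : ∀ v ∈ σ.support, v ∈ spinSites s ω ∩ P ∧ v ∉ box 2 n)
    {x₀ u : Site 2} (hK : (siteCluster zdStarGraph (spinSites s ω ∩ P) x₀).Infinite)
    (hu : u ∈ siteCluster zdStarGraph (spinSites s ω ∩ P) x₀) (hun : u ∈ box 2 n) :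
    ∀ v ∈ σ.support, v ∈ siteCluster zdStarGraph (spinSites s ω ∩ P) x₀ := by
  classical
  set O := spinSites s ω ∩ P with hO
  obtain ⟨σ', hσ'⟩ := exists_reflected_starWalk σ
  obtain ⟨H, hH⟩ := (eventually_subset_box_holds (d := 2) (σ.support.toFinset ∪ σ'.support.toFinset)).exists
  obtain ⟨w, hw, hwH⟩ := hK.exists_notMem_finset (box 2 H)
  obtain ⟨p, hp⟩ := exists_walk_of_mem_siteCluster hu hw
  have hpK : ∀ z ∈ p.support, z ∈ siteCluster zdStarGraph O x₀ := fun z hz => mem_siteCluster_of_mem_support hu p hp hz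
  obtain ⟨βw, hβw⟩ := exists_latticeWalk_of_starWalk_height p
  have hun' : -(n : ℤ) ≤ u 0 ∧ u 0 ≤ n ∧ -(n : ℤ) ≤ u 1 ∧ u 1 ≤ n := by
    rw [mem_box, Fin.forall_fin_two] at hun; exact ⟨hun.1.1, hun.1.2, hun.2.1, hun.2.2⟩
  obtain ⟨z, hzβ, hz⟩ := exists_mem_support_of_bandSemicircuits (m := n) (c₁ := -(n : ℤ)) (c₂ := n)
    ha hb (xL := ![a, 0]) (xR := ![b, 0]) (by simp) (by simp) (by simp) (by simp)
    σ (fun z hz h => by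
      obtain ⟨⟨-, hzP⟩, hzn⟩ := hσ z hz
      have hz1 : 0 ≤ z 1 := hP hzP
      exact hzn (by rw [mem_box, Fin.forall_fin_two]; omega))
    σ' (fun z hz h => by
      obtain ⟨⟨-, hzP⟩, hzn⟩ := hσ _ ((hσ' z).1 hz)
      have hz1 : 0 ≤ (reflectCoord (d := 2) 1 z) 1 := hP hzP
      have hR0 : (reflectCoord (d := 2) 1 z) 0 = z 0 := Rf_apply_zero z
      have hR1 : (reflectCoord (d := 2) 1 z) 1 = -z 1 := Rf_apply_one z
      refine hzn ?_
      rw [mem_box, Fin.forall_fin_two, hR0, hR1]; rw [hR1] at hz1; omega)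
    (H := H) (fun z hz => hH (Finset.mem_union_left _ (List.mem_toFinset.2 hz)))
    (fun z hz => hH (Finset.mem_union_right _ (List.mem_toFinset.2 hz)))
    (u := u) (w := w) hun' hwH βw
  -- `z` lies on `σ` (an axis site of the mirror image is on `σ` too)
  obtain ⟨⟨k, hk, hzk⟩, k', hk', hzk'⟩ := hβw z hzβ
  have hz1 : 0 ≤ z 1 := by rw [hzk']; exact hP (hp k' hk').2
  have hzσ : z ∈ σ.support := by
    rcases hz with hz | hz
    · exact hz
    · have hmem := (hσ' z).1 hz
      have hR1 : (reflectCoord (d := 2) 1 z) 1 = -z 1 := Rf_apply_one z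
      have h0 : 0 ≤ (reflectCoord (d := 2) 1 z) 1 := hP (hσ _ hmem).1.2
      have hz0 : z 1 = 0 := by rw [hR1] at h0; omega
      rwa [reflectCoord_one_eq_self_of_apply_one hz0] at hmem
  have hzO : z ∈ O := (hσ z hzσ).1
  have hzK : z ∈ siteCluster zdStarGraph O x₀ := by
    rcases hzk with heq | hadj
    · rw [heq]; exact hpK k hk
    · exact mem_siteCluster_of_adj (hpK k hk) hzO (zdGraph_le_zdStarGraph hadj.symm)
  -- hence the start of `σ`, hence all of `σ`
  have haK : (![a, 0] : Site 2) ∈ siteCluster zdStarGraph O x₀ :=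
    mem_siteCluster_of_walk hzK (σ.takeUntil z hzσ).reverse fun v hv => by
      rw [Walk.support_reverse, List.mem_reverse] at hv
      exact (hσ v (σ.support_takeUntil_subset_support hzσ hv)).1
  exact fun v hv => mem_siteCluster_of_mem_support haK σ (fun y hy => (hσ y hy).1) hv

/-- **Semicircuits around every box from the finiteness of the opposite lattice clusters**
("each finite subset of `π_up` is surrounded by a `-∗`semicircuit in `π_up`", Georgii–Higuchi 2000,
Lemma 5.5 Case 1; half-annulus duality `exists_starSemicircuit_or_latticeEscape`). [cite: GeorgiiHiguchi2000, Lemma 5.5 (proof, Case 1)] -/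
theorem exists_starSemicircuit_of_latticeClusters_finite
    (hfin : ∀ y, (siteCluster (zdGraph 2) (spinSites (-s) ω ∩ halfPlane 0) y).Finite) (n : ℕ) :
    ∃ (a b : ℤ) (σ : zdStarGraph.Walk (![a, 0] : Site 2) ![b, 0]), a < -(n : ℤ) ∧ (n : ℤ) < b ∧
      ∀ v ∈ σ.support, ω v = s ∧ 0 ≤ v 1 ∧ v ∉ box 2 n := by
  classical
  -- a box containing the `(-s)`-clusters of the sites near `Λ_n`
  set U : Set (Site 2) := ⋃ c ∈ (box 2 (n + 1) : Finset (Site 2)), siteCluster (zdGraph 2) (spinSites (-s) ω ∩ halfPlane 0) c with hU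
  have hUfin : U.Finite := Set.Finite.biUnion (box 2 (n + 1)).finite_toSet fun c _ => hfin c
  obtain ⟨H, hH⟩ := (eventually_subset_box_holds (d := 2) hUfin.toFinset).exists
  set N : ℕ := max (H + 1) (n + 1) with hN
  have hnN : n < N := by omega
  rcases exists_starSemicircuit_or_latticeEscape hnN (spinSites s ω) with ⟨a, b, w, ⟨c, hc, hac⟩, ⟨i, hi⟩, hw⟩ | ⟨a, b, q, ha1, hb1, ha0, hb0, hq⟩
  · exfalso
    -- the escaping `(-s)`-walk stays in the cluster of `a`, inside `Λ_H`
    have haO : ∀ v ∈ w.support, v ∈ spinSites (-s) ω ∩ halfPlane 0 := by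
      intro v hv
      obtain ⟨hva, hvO⟩ := hw v hv
      refine ⟨?_, hva.2.2⟩
      rcases units_eq_or_eq_neg s (ω v) with h | h
      · exact absurd h hvO
      · exact h
    have ha_self : a ∈ siteCluster (zdGraph 2) (spinSites (-s) ω ∩ halfPlane 0) a :=
      (mem_siteCluster_self_iff _ _ _).2 (haO a (Walk.start_mem_support w))
    have hb_mem : b ∈ siteCluster (zdGraph 2) (spinSites (-s) ω ∩ halfPlane 0) a :=
      mem_siteCluster_of_walk ha_self w haO
    have ha_box : a ∈ box 2 (n + 1) := mem_box_succ_of_zdAdj hc hac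
    have hbU : b ∈ U := Set.mem_biUnion (Finset.mem_coe.2 ha_box) hb_mem
    have hbH : b ∈ box 2 H := hH ((Set.Finite.mem_toFinset hUfin).2 hbU)
    rw [mem_box] at hbH
    have := hbH i
    rw [abs_eq (by positivity : (0 : ℤ) ≤ N)] at hi
    rcases hi with hi | hi <;> omega
  · refine ⟨a 0, b 0, q.copy (eq_axis_of_apply_one ha1) (eq_axis_of_apply_one hb1), ha0, hb0, fun v hv => ?_⟩
    rw [Walk.support_copy] at hv
    obtain ⟨hva, hvO⟩ := hq v hv
    exact ⟨hvO, hva.2.2, hva.2.1⟩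

end Geometry

/-! ### The almost-sure structure: two-sidedness and uniqueness off the box -/

section Structure

variable {ν : Measure (SpinConfig (Site 2))}

/-- **Two-sidedness and uniqueness off the box, almost surely** (Georgii–Higuchi 2000, Lemma 5.5
Case 1: "an infinite `-∗`cluster `I^{-∗}_up` exists and touches both `ℓ_left` and `ℓ_right`
infinitely often", and the uniqueness of Lemma 4.1): if almost surely `π_up` has no infinite
`(-s)`-lattice cluster, then almost surely (i) every infinite `∗`-cluster of `S^s ∩ π_up` has axis
sites below `-n` and above `n` for every `n`, and (ii) for every `m`, any two infinite `∗`-clusters of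
`S^s ∩ (π_up ∖ Λ_m)` coincide. [cite: GeorgiiHiguchi2000, Lemma 5.5 (proof, Case 1) and Lemma 4.1] -/
theorem ae_singleSign_structure [IsProbabilityMeasure ν] (s : ℤˣ)
    (hNo : ν (existsInfClusterIn (zdGraph 2) (-s) (halfPlane 0)) = 0) :
    ∀ᵐ ω ∂ν,
      (∀ x₀, (siteCluster zdStarGraph (spinSites s ω ∩ halfPlane 0) x₀).Infinite →
        ∀ n : ℕ, (∃ k : ℤ, k < -(n : ℤ) ∧ (![k, 0] : Site 2) ∈ siteCluster zdStarGraph (spinSites s ω ∩ halfPlane 0) x₀) ∧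
          (∃ k : ℤ, (n : ℤ) < k ∧ (![k, 0] : Site 2) ∈ siteCluster zdStarGraph (spinSites s ω ∩ halfPlane 0) x₀)) ∧
      (∀ (m : ℕ) (x₁ x₂ : Site 2),
        (siteCluster zdStarGraph (spinSites s ω ∩ (halfPlane 0 \ ↑(box 2 m))) x₁).Infinite →
        (siteCluster zdStarGraph (spinSites s ω ∩ (halfPlane 0 \ ↑(box 2 m))) x₂).Infinite →
          siteCluster zdStarGraph (spinSites s ω ∩ (halfPlane 0 \ ↑(box 2 m))) x₁ =
            siteCluster zdStarGraph (spinSites s ω ∩ (halfPlane 0 \ ↑(box 2 m))) x₂) := by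
  classical
  filter_upwards [measure_eq_zero_iff_ae_notMem.1 hNo] with ω hω
  have hfin : ∀ y, (siteCluster (zdGraph 2) (spinSites (-s) ω ∩ halfPlane 0) y).Finite := by
    intro y
    by_contra h
    exact hω ⟨y, Set.not_finite.1 h⟩
  have hself : ∀ {O : Set (Site 2)} {x : Site 2}, (siteCluster zdStarGraph O x).Infinite →
      x ∈ siteCluster zdStarGraph O x := fun h =>
    (mem_siteCluster_self_iff _ _ _).2 (by obtain ⟨p, hp⟩ := h.nonempty; exact hp.1)
  have hbox : ∀ x : Site 2, x ∈ box 2 (max (x 0).natAbs (x 1).natAbs) := fun x => by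
    rw [mem_box, Fin.forall_fin_two]
    have h0 : ((x 0).natAbs : ℤ) ≤ max (x 0).natAbs (x 1).natAbs := by exact_mod_cast le_max_left _ _
    have h1 : ((x 1).natAbs : ℤ) ≤ max (x 0).natAbs (x 1).natAbs := by exact_mod_cast le_max_right _ _
    omega
  constructor
  · intro x₀ hK n
    set n' : ℕ := max n (max (x₀ 0).natAbs (x₀ 1).natAbs) with hn'
    obtain ⟨a, b, σ, ha, hb, hσ⟩ := exists_starSemicircuit_of_latticeClusters_finite hfin n'
    have hsub := support_subset_siteCluster_of_starSemicircuit (P := halfPlane 0) (s := s) le_rfl ha hb σ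
      (fun v hv => ⟨⟨(hσ v hv).1, (hσ v hv).2.1⟩, (hσ v hv).2.2⟩) hK (hself hK)
      (box_mono 2 (le_max_right _ _) (hbox x₀))
    exact ⟨⟨a, by omega, hsub _ (Walk.start_mem_support σ)⟩, ⟨b, by omega, hsub _ (Walk.end_mem_support σ)⟩⟩
  · intro m x₁ x₂ h₁ h₂
    set n' : ℕ := max m (max (max (x₁ 0).natAbs (x₁ 1).natAbs) (max (x₂ 0).natAbs (x₂ 1).natAbs)) with hn'
    obtain ⟨a, b, σ, ha, hb, hσ⟩ := exists_starSemicircuit_of_latticeClusters_finite hfin n'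
    have hσP : ∀ v ∈ σ.support, v ∈ spinSites s ω ∩ (halfPlane 0 \ ↑(box 2 m)) ∧ v ∉ box 2 n' := fun v hv =>
      ⟨⟨(hσ v hv).1, (hσ v hv).2.1, fun h => (hσ v hv).2.2 (box_mono 2 (le_max_left _ _) h)⟩, (hσ v hv).2.2⟩
    have hPsub : (halfPlane 0 \ ↑(box 2 m) : Set (Site 2)) ⊆ halfPlane 0 := Set.sdiff_subset
    have hs₁ := support_subset_siteCluster_of_starSemicircuit hPsub ha hb σ hσP h₁ (hself h₁)
      (box_mono 2 ((le_max_left _ _).trans (le_max_right _ _)) (hbox x₁)) _ (Walk.start_mem_support σ)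
    have hs₂ := support_subset_siteCluster_of_starSemicircuit hPsub ha hb σ hσP h₂ (hself h₂)
      (box_mono 2 ((le_max_right _ _).trans (le_max_right _ _)) (hbox x₂)) _ (Walk.start_mem_support σ)
    exact siteCluster_eq_of_mem hs₁ hs₂

end Structure

/-! ### The `s∗`walk from the two pins -/

section Pins

variable {ν : Measure (SpinConfig (Site 2))}

/-- **Both ends pinned to the infinite `s∗`-component give the `s∗`walk above the box**
(Georgii–Higuchi 2000, Lemma 5.5 Case 1: "By the pinning lemma and the positive correlations of `μ`,
with `μ`-probability at least `(θ/4)²` both `x` and `y` are `-∗`connected to `I^{-∗}_up` outside `Δ`,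
and therefore also `-∗`connected to each other by a `-∗`path `p` above `Δ`"): FKG for the two
(monotone) pinning events and the uniqueness of the infinite `∗`-component off the box. [cite: GeorgiiHiguchi2000, Lemma 5.5 (proof, Case 1)] -/
theorem le_measureReal_starWalk_of_pins (hβ : 0 ≤ β) (hν : ν ∈ isingGibbsMeasures 2 β 0) (hνt : IsTailTrivial ν)
    (s : ℤˣ) (m : ℕ) (hNo : ν (existsInfClusterIn (zdGraph 2) (-s) (halfPlane 0)) = 0)
    (x y : Site 2) {Q : Site 2 → Prop} (hQ : ∀ v : Site 2, 0 ≤ v 1 → v ∉ box 2 m → Q v) {cP : ℝ} (hcP : 0 ≤ cP)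
    (hpx : cP ≤ ν.real {ω : SpinConfig (Site 2) | ∃ z, (siteCluster zdStarGraph (spinSites s ω ∩ (halfPlane 0 \ ↑(box 2 m))) z).Infinite ∧
      ∃ w : zdStarGraph.Walk x z, ∀ v ∈ w.support, ω v = s ∧ Q v})
    (hpy : cP ≤ ν.real {ω : SpinConfig (Site 2) | ∃ z, (siteCluster zdStarGraph (spinSites s ω ∩ (halfPlane 0 \ ↑(box 2 m))) z).Infinite ∧
      ∃ w : zdStarGraph.Walk y z, ∀ v ∈ w.support, ω v = s ∧ Q v}) :
    cP * cP ≤ ν.real {ω : SpinConfig (Site 2) | ∃ w : zdStarGraph.Walk x y, ∀ v ∈ w.support, ω v = s ∧ Q v} := by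
  classical
  have hνG : IsGibbsMeasure (isingSpecification (zdGraph 2) β 0) ν := hν
  haveI := hνG.isProbabilityMeasure
  -- FKG, by the sign
  have hfkg : ∀ {D E : Set (SpinConfig (Site 2))}, (s = 1 → IsUpperSet D ∧ IsUpperSet E) →
      (s = -1 → IsLowerSet D ∧ IsLowerSet E) → MeasurableSet D → MeasurableSet E →
      ν.real D * ν.real E ≤ ν.real (D ∩ E) := by
    intro D E hup hlow hDm hEm
    rcases Int.units_eq_one_or s with h | h
    · exact measureReal_inter_ge_mul_of_isUpperSet hβ hν hνt (hup h).1 (hup h).2 hDm hEm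
    · exact measureReal_inter_ge_mul_of_isLowerSet hβ hν hνt (hlow h).1 (hlow h).2 hDm hEm
  have hself : ∀ {O : Set (Site 2)} {z : Site 2}, (siteCluster zdStarGraph O z).Infinite →
      z ∈ siteCluster zdStarGraph O z := fun h =>
    (mem_siteCluster_self_iff _ _ _).2 (by obtain ⟨p, hp⟩ := h.nonempty; exact hp.1)
  calc cP * cP ≤ _ * _ := mul_le_mul hpx hpy hcP measureReal_nonneg
    _ ≤ _ := hfkg (fun h => by subst h; exact ⟨isUpperSet_starPin_one _ _ _, isUpperSet_starPin_one _ _ _⟩)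
        (fun h => by subst h; exact ⟨isLowerSet_starPin_neg_one _ _ _, isLowerSet_starPin_neg_one _ _ _⟩)
        (measurableSet_starPin _ _ _ _) (measurableSet_starPin _ _ _ _)
    _ ≤ _ := by
      simp only [measureReal_def]
      refine ENNReal.toReal_mono (measure_ne_top _ _) (measure_mono_ae ?_)
      filter_upwards [ae_singleSign_structure s hNo] with ω hstr
      rintro ⟨⟨z₁, hz₁, w₁, hw₁⟩, ⟨z₂, hz₂, w₂, hw₂⟩⟩
      have heq := hstr.2 m z₁ z₂ hz₁ hz₂
      have hz₂mem : z₂ ∈ siteCluster zdStarGraph (spinSites s ω ∩ (halfPlane 0 \ ↑(box 2 m))) z₁ := by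
        rw [heq]; exact hself hz₂
      obtain ⟨q, hq⟩ := exists_walk_of_mem_siteCluster (hself hz₁) hz₂mem
      refine ⟨w₁.append (q.append w₂.reverse), fun v hv => ?_⟩
      rw [Walk.mem_support_append_iff, Walk.mem_support_append_iff, Walk.support_reverse, List.mem_reverse] at hv
      rcases hv with hv | hv | hv
      · exact hw₁ v hv
      · obtain ⟨hvs, hv0, hvb⟩ := hq v hv
        exact ⟨hvs, hQ v hv0 hvb⟩
      · exact hw₂ v hv

end Pins

/-! ### The claim of Lemma 5.5 in Cases 1 and 2 -/

section Main

variable {μ : Measure (SpinConfig (Site 2))}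

/-- Transport of `E^s_{π_up}` under a horizontal shift. [folklore] -/
theorem preimage_configShift_single_zero_existsInfClusterIn_halfPlane (t : ℤ) (s : ℤˣ) :
    (configShift (S := ℤˣ) (Pi.single (0 : Fin 2) t : Site 2)) ⁻¹' (existsInfClusterIn (zdGraph 2) s (halfPlane 0) : Set (SpinConfig (Site 2))) =
      existsInfClusterIn (zdGraph 2) s (halfPlane 0) := by
  ext ω
  have hcfg : (configShift (S := ℤˣ) (Pi.single (0 : Fin 2) t : Site 2) ω : SpinConfig (Site 2)) =
      configRelabel (zdShiftIso (d := 2) (Pi.single 0 t)).toEquiv ω := rfl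
  rw [Set.mem_preimage, hcfg, configRelabel_mem_existsInfClusterIn_iff]
  have : (zdShiftIso (d := 2) (Pi.single (0 : Fin 2) t : Site 2)) ⁻¹' (halfPlane 0) = halfPlane 0 := by
    ext z; simp [halfPlane]
  rw [this]

/-- **Georgii–Higuchi 2000, Lemma 5.5, the claim in Case 1** (`-`path in the first layer): for
`β > β_c(2)`, a tail-trivial `μ ∈ 𝒢(β, 0)` with an infinite `-`cluster but no infinite `+`cluster in
`π_up`, and the `-∗`pinning bounds for far axis sites (constant `c_P > 0`, off every box), for every
`n` and all `a, b` large, with `μ ⊗ (μ∘θ_{s e₁}⁻¹)`-probability `≥ c_P²` some `∗`-walk of good sites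
joins `(-a, 0)` to `(b, 0)` above the band `{|z₁| ≤ n, z₂ ≤ n}`. [cite: GeorgiiHiguchi2000, Lemma 5.5 (proof, Case 1)] -/
theorem upperGoodCrossing_bound_of_singleSign_minus (hβc : criticalBeta 2 < β) (hμ : μ ∈ isingGibbsMeasures 2 β 0)
    (hμt : IsTailTrivial μ) (s : ℤˣ)
    (hM : ∀ᵐ ω ∂μ, ∃ y, (siteCluster (zdGraph 2) (spinSites (-1) ω ∩ halfPlane 0) y).Infinite)
    (hNoP : μ (existsInfClusterIn (zdGraph 2) 1 (halfPlane 0)) = 0)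
    (hPinL : ∀ μ' : Measure (SpinConfig (Site 2)), μ' ∈ isingGibbsMeasures 2 β 0 → IsTailTrivial μ' →
      (∀ᵐ ω ∂μ', ∃ x, ∀ n : ℕ, ∃ k : ℤ, k < -(n : ℤ) ∧
        (![k, 0] : Site 2) ∈ siteCluster zdStarGraph (spinSites (-1) ω ∩ halfPlane 0) x) →
      ∃ cP : ℝ, 0 < cP ∧ ∀ m : ℕ, ∃ a₀ : ℕ, ∀ a : ℕ, a₀ ≤ a → cP ≤ μ'.real
        {ω : SpinConfig (Site 2) | ∃ z, (siteCluster zdStarGraph (spinSites (-1) ω ∩ (halfPlane 0 \ ↑(box 2 m))) z).Infinite ∧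
          ∃ w : zdStarGraph.Walk (![-(a : ℤ), 0]) z, ∀ v ∈ w.support,
            ω v = -1 ∧ ¬ (-(m : ℤ) ≤ v 0 ∧ v 0 ≤ m ∧ v 1 ≤ m)})
    (hPinR : ∀ μ' : Measure (SpinConfig (Site 2)), μ' ∈ isingGibbsMeasures 2 β 0 → IsTailTrivial μ' →
      (∀ᵐ ω ∂μ', ∃ x, ∀ n : ℕ, ∃ k : ℤ, (n : ℤ) < k ∧
        (![k, 0] : Site 2) ∈ siteCluster zdStarGraph (spinSites (-1) ω ∩ halfPlane 0) x) →
      ∃ cP : ℝ, 0 < cP ∧ ∀ m : ℕ, ∃ b₀ : ℕ, ∀ b : ℕ, b₀ ≤ b → cP ≤ μ'.real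
        {ω : SpinConfig (Site 2) | ∃ z, (siteCluster zdStarGraph (spinSites (-1) ω ∩ (halfPlane 0 \ ↑(box 2 m))) z).Infinite ∧
          ∃ w : zdStarGraph.Walk (![(b : ℤ), 0]) z, ∀ v ∈ w.support,
            ω v = -1 ∧ ¬ (-(m : ℤ) ≤ v 0 ∧ v 0 ≤ m ∧ v 1 ≤ m)}) :
    ∃ c : ℝ≥0∞, 0 < c ∧ ∀ n : ℕ, ∃ a₀ b₀ : ℕ, ∀ a b : ℕ, a₀ ≤ a → b₀ ≤ b →
      c ≤ (μ.prod (μ.map (configShift (Pi.single 0 (s : ℤ)))))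
        {p | ∃ α : zdStarGraph.Walk (![-(a : ℤ), 0]) (![(b : ℤ), 0]),
          ∀ z ∈ α.support, p.1 z ≤ p.2 z ∧ ¬ (-(n : ℤ) ≤ z 0 ∧ z 0 ≤ n ∧ z 1 ≤ n)} := by
  classical
  have hβ : 0 ≤ β := (criticalBeta_nonneg 2).trans hβc.le
  have hμG : IsGibbsMeasure (isingSpecification (zdGraph 2) β 0) μ := hμ
  haveI := hμG.isProbabilityMeasure
  haveI : IsProbabilityMeasure (μ.map (configShift (S := ℤˣ) (Pi.single (0 : Fin 2) (s : ℤ) : Site 2))) :=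
    Measure.isProbabilityMeasure_map (configShift _).measurable.aemeasurable
  -- the infinite `-∗`cluster of `π_up` touches both half-axes unboundedly
  have hNo : μ (existsInfClusterIn (zdGraph 2) (-(-1 : ℤˣ)) (halfPlane 0)) = 0 := by simpa using hNoP
  have hD : ∀ᵐ ω ∂μ, ∃ x, (siteCluster zdStarGraph (spinSites (-1) ω ∩ halfPlane 0) x).Infinite := by
    filter_upwards [hM] with ω ⟨y, hy⟩
    refine ⟨y, hy.mono fun z hz => ⟨hz.1, hz.2.1, hz.2.2.mono ?_⟩⟩
    intro a b hab
    rw [siteOpenGraph_adj] at hab ⊢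
    exact ⟨zdGraph_le_zdStarGraph hab.1, hab.2.1, hab.2.2⟩
  have hL : ∀ᵐ ω ∂μ, ∃ x, ∀ n : ℕ, ∃ k : ℤ, k < -(n : ℤ) ∧
      (![k, 0] : Site 2) ∈ siteCluster zdStarGraph (spinSites (-1) ω ∩ halfPlane 0) x := by
    filter_upwards [ae_singleSign_structure (-1) hNo, hD] with ω hstr hx
    obtain ⟨x, hx⟩ := hx
    exact ⟨x, fun n => (hstr.1 x hx n).1⟩
  have hR : ∀ᵐ ω ∂μ, ∃ x, ∀ n : ℕ, ∃ k : ℤ, (n : ℤ) < k ∧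
      (![k, 0] : Site 2) ∈ siteCluster zdStarGraph (spinSites (-1) ω ∩ halfPlane 0) x := by
    filter_upwards [ae_singleSign_structure (-1) hNo, hD] with ω hstr hx
    obtain ⟨x, hx⟩ := hx
    exact ⟨x, fun n => (hstr.1 x hx n).2⟩
  obtain ⟨cP₁, hcP₁, hPinL'⟩ := hPinL μ hμ hμt hL
  obtain ⟨cP₂, hcP₂, hPinR'⟩ := hPinR μ hμ hμt hR
  set cP : ℝ := min cP₁ cP₂ with hcPdef
  have hcP : 0 < cP := lt_min hcP₁ hcP₂
  refine ⟨ENNReal.ofReal (cP * cP), ENNReal.ofReal_pos.2 (mul_pos hcP hcP), fun n => ?_⟩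
  obtain ⟨a₀, ha₀⟩ := hPinL' n
  obtain ⟨b₀, hb₀⟩ := hPinR' n
  refine ⟨a₀, b₀, fun a b ha hb => ?_⟩
  have hQ : ∀ v : Site 2, 0 ≤ v 1 → v ∉ box 2 n → ¬ (-(n : ℤ) ≤ v 0 ∧ v 0 ≤ n ∧ v 1 ≤ n) := by
    intro v hv hvb h
    apply hvb
    rw [mem_box, Fin.forall_fin_two]; omega
  have key := le_measureReal_starWalk_of_pins hβ hμ hμt (-1) n hNo (![-(a : ℤ), 0]) (![(b : ℤ), 0]) hQ hcP.le
    ((min_le_left _ _).trans (ha₀ a ha)) ((min_le_right _ _).trans (hb₀ b hb))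
  -- embed the first layer into the duplicated system
  set A : Set (SpinConfig (Site 2)) := {ω | ∃ w : zdStarGraph.Walk (![-(a : ℤ), 0]) (![(b : ℤ), 0]),
    ∀ v ∈ w.support, ω v = -1 ∧ ¬ (-(n : ℤ) ≤ v 0 ∧ v 0 ≤ n ∧ v 1 ≤ n)} with hA
  have hsub : A ×ˢ (Set.univ : Set (SpinConfig (Site 2))) ⊆
      {p : SpinConfig (Site 2) × SpinConfig (Site 2) | ∃ α : zdStarGraph.Walk (![-(a : ℤ), 0]) (![(b : ℤ), 0]),
        ∀ z ∈ α.support, p.1 z ≤ p.2 z ∧ ¬ (-(n : ℤ) ≤ z 0 ∧ z 0 ≤ n ∧ z 1 ≤ n)} := by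
    rintro p ⟨⟨w, hw⟩, -⟩
    exact ⟨w, fun z hz => ⟨by rw [(hw z hz).1]; exact neg_one_le_intUnits _, (hw z hz).2⟩⟩
  calc ENNReal.ofReal (cP * cP) ≤ ENNReal.ofReal (μ.real A) := ENNReal.ofReal_le_ofReal key
    _ = μ A := by rw [measureReal_def, ENNReal.ofReal_toReal (measure_ne_top _ _)]
    _ = (μ.prod (μ.map (configShift (Pi.single 0 (s : ℤ))))) (A ×ˢ Set.univ) := by
        rw [Measure.prod_prod, measure_univ, mul_one]
    _ ≤ _ := measure_mono hsub

/-- **Georgii–Higuchi 2000, Lemma 5.5, the claim in Case 2** (`+`path in the second layer): for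
`β > β_c(2)`, a tail-trivial `μ ∈ 𝒢(β, 0)` with an infinite `+`cluster but no infinite `-`cluster in
`π_up`, and the `+∗`pinning bounds, the same conclusion. [cite: GeorgiiHiguchi2000, Lemma 5.5 (proof, Case 2)] -/
theorem upperGoodCrossing_bound_of_singleSign_plus (hβc : criticalBeta 2 < β) (hμ : μ ∈ isingGibbsMeasures 2 β 0)
    (hμt : IsTailTrivial μ) (s : ℤˣ)
    (hP : ∀ᵐ ω ∂μ, ∃ x, (siteCluster (zdGraph 2) (spinSites 1 ω ∩ halfPlane 0) x).Infinite)
    (hNoM : μ (existsInfClusterIn (zdGraph 2) (-1) (halfPlane 0)) = 0)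
    (hPinL : ∀ μ' : Measure (SpinConfig (Site 2)), μ' ∈ isingGibbsMeasures 2 β 0 → IsTailTrivial μ' →
      (∀ᵐ ω ∂μ', ∃ x, ∀ n : ℕ, ∃ k : ℤ, k < -(n : ℤ) ∧
        (![k, 0] : Site 2) ∈ siteCluster zdStarGraph (spinSites 1 ω ∩ halfPlane 0) x) →
      ∃ cP : ℝ, 0 < cP ∧ ∀ m : ℕ, ∃ a₀ : ℕ, ∀ a : ℕ, a₀ ≤ a → cP ≤ μ'.real
        {ω : SpinConfig (Site 2) | ∃ z, (siteCluster zdStarGraph (spinSites 1 ω ∩ (halfPlane 0 \ ↑(box 2 m))) z).Infinite ∧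
          ∃ w : zdStarGraph.Walk (![-(a : ℤ), 0]) z, ∀ v ∈ w.support,
            ω v = 1 ∧ ¬ (-(m : ℤ) ≤ v 0 ∧ v 0 ≤ m ∧ v 1 ≤ m)})
    (hPinR : ∀ μ' : Measure (SpinConfig (Site 2)), μ' ∈ isingGibbsMeasures 2 β 0 → IsTailTrivial μ' →
      (∀ᵐ ω ∂μ', ∃ x, ∀ n : ℕ, ∃ k : ℤ, (n : ℤ) < k ∧
        (![k, 0] : Site 2) ∈ siteCluster zdStarGraph (spinSites 1 ω ∩ halfPlane 0) x) →
      ∃ cP : ℝ, 0 < cP ∧ ∀ m : ℕ, ∃ b₀ : ℕ, ∀ b : ℕ, b₀ ≤ b → cP ≤ μ'.real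
        {ω : SpinConfig (Site 2) | ∃ z, (siteCluster zdStarGraph (spinSites 1 ω ∩ (halfPlane 0 \ ↑(box 2 m))) z).Infinite ∧
          ∃ w : zdStarGraph.Walk (![(b : ℤ), 0]) z, ∀ v ∈ w.support,
            ω v = 1 ∧ ¬ (-(m : ℤ) ≤ v 0 ∧ v 0 ≤ m ∧ v 1 ≤ m)}) :
    ∃ c : ℝ≥0∞, 0 < c ∧ ∀ n : ℕ, ∃ a₀ b₀ : ℕ, ∀ a b : ℕ, a₀ ≤ a → b₀ ≤ b →
      c ≤ (μ.prod (μ.map (configShift (Pi.single 0 (s : ℤ)))))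
        {p | ∃ α : zdStarGraph.Walk (![-(a : ℤ), 0]) (![(b : ℤ), 0]),
          ∀ z ∈ α.support, p.1 z ≤ p.2 z ∧ ¬ (-(n : ℤ) ≤ z 0 ∧ z 0 ≤ n ∧ z 1 ≤ n)} := by
  classical
  have hβ : 0 ≤ β := (criticalBeta_nonneg 2).trans hβc.le
  have hμG : IsGibbsMeasure (isingSpecification (zdGraph 2) β 0) μ := hμ
  haveI := hμG.isProbabilityMeasure
  set θ := configShift (S := ℤˣ) (Pi.single (0 : Fin 2) (s : ℤ) : Site 2) with hθ
  have hθm : Measurable θ := (configShift _).measurable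
  have hμv : μ.map θ ∈ isingGibbsMeasures 2 β 0 := mem_isingGibbsMeasures_map_configShift hμ _
  have hμvt : IsTailTrivial (μ.map θ) := hμt.map_configRelabel (Site.shift _)
  haveI : IsProbabilityMeasure (μ.map θ) := Measure.isProbabilityMeasure_map hθm.aemeasurable
  -- the second layer has the same half-plane structure
  have hmeasE : ∀ (s' : ℤˣ), MeasurableSet (existsInfClusterIn (zdGraph 2) s' (halfPlane 0) : Set (SpinConfig (Site 2))) :=
    fun s' => MeasurableSet.of_tailEvents (measurableSet_tailEvents_existsInfClusterIn (G := zdGraph 2) s' _)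
  have hNo' : (μ.map θ) (existsInfClusterIn (zdGraph 2) (-(1 : ℤˣ)) (halfPlane 0)) = 0 := by
    rw [hθ, Measure.map_apply hθm (hmeasE _), preimage_configShift_single_zero_existsInfClusterIn_halfPlane]
    exact hNoM
  have hP' : ∀ᵐ ω ∂(μ.map θ), ∃ x, (siteCluster (zdGraph 2) (spinSites 1 ω ∩ halfPlane 0) x).Infinite := by
    have : ∀ᵐ ω ∂(μ.map θ), ω ∈ existsInfClusterIn (zdGraph 2) 1 (halfPlane 0) := by
      rw [ae_map_iff hθm.aemeasurable (p := fun ω => ω ∈ existsInfClusterIn (zdGraph 2) 1 (halfPlane 0)) (hmeasE 1)]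
      filter_upwards [hP] with ω hω
      show ω ∈ θ ⁻¹' existsInfClusterIn (zdGraph 2) 1 (halfPlane 0)
      rw [hθ, preimage_configShift_single_zero_existsInfClusterIn_halfPlane]; exact hω
    exact this
  have hD' : ∀ᵐ ω ∂(μ.map θ), ∃ x, (siteCluster zdStarGraph (spinSites 1 ω ∩ halfPlane 0) x).Infinite := by
    filter_upwards [hP'] with ω ⟨y, hy⟩
    refine ⟨y, hy.mono fun z hz => ⟨hz.1, hz.2.1, hz.2.2.mono ?_⟩⟩
    intro a b hab
    rw [siteOpenGraph_adj] at hab ⊢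
    exact ⟨zdGraph_le_zdStarGraph hab.1, hab.2.1, hab.2.2⟩
  have hL : ∀ᵐ ω ∂(μ.map θ), ∃ x, ∀ n : ℕ, ∃ k : ℤ, k < -(n : ℤ) ∧
      (![k, 0] : Site 2) ∈ siteCluster zdStarGraph (spinSites 1 ω ∩ halfPlane 0) x := by
    filter_upwards [ae_singleSign_structure 1 hNo', hD'] with ω hstr hx
    obtain ⟨x, hx⟩ := hx
    exact ⟨x, fun n => (hstr.1 x hx n).1⟩
  have hR : ∀ᵐ ω ∂(μ.map θ), ∃ x, ∀ n : ℕ, ∃ k : ℤ, (n : ℤ) < k ∧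
      (![k, 0] : Site 2) ∈ siteCluster zdStarGraph (spinSites 1 ω ∩ halfPlane 0) x := by
    filter_upwards [ae_singleSign_structure 1 hNo', hD'] with ω hstr hx
    obtain ⟨x, hx⟩ := hx
    exact ⟨x, fun n => (hstr.1 x hx n).2⟩
  obtain ⟨cP₁, hcP₁, hPinL'⟩ := hPinL _ hμv hμvt hL
  obtain ⟨cP₂, hcP₂, hPinR'⟩ := hPinR _ hμv hμvt hR
  set cP : ℝ := min cP₁ cP₂ with hcPdef
  have hcP : 0 < cP := lt_min hcP₁ hcP₂
  refine ⟨ENNReal.ofReal (cP * cP), ENNReal.ofReal_pos.2 (mul_pos hcP hcP), fun n => ?_⟩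
  obtain ⟨a₀, ha₀⟩ := hPinL' n
  obtain ⟨b₀, hb₀⟩ := hPinR' n
  refine ⟨a₀, b₀, fun a b ha hb => ?_⟩
  have hQ : ∀ v : Site 2, 0 ≤ v 1 → v ∉ box 2 n → ¬ (-(n : ℤ) ≤ v 0 ∧ v 0 ≤ n ∧ v 1 ≤ n) := by
    intro v hv hvb h
    apply hvb
    rw [mem_box, Fin.forall_fin_two]; omega
  have key := le_measureReal_starWalk_of_pins hβ hμv hμvt 1 n hNo' (![-(a : ℤ), 0]) (![(b : ℤ), 0]) hQ hcP.le
    ((min_le_left _ _).trans (ha₀ a ha)) ((min_le_right _ _).trans (hb₀ b hb))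
  set A : Set (SpinConfig (Site 2)) := {ω | ∃ w : zdStarGraph.Walk (![-(a : ℤ), 0]) (![(b : ℤ), 0]),
    ∀ v ∈ w.support, ω v = 1 ∧ ¬ (-(n : ℤ) ≤ v 0 ∧ v 0 ≤ n ∧ v 1 ≤ n)} with hA
  have hsub : (Set.univ : Set (SpinConfig (Site 2))) ×ˢ A ⊆
      {p : SpinConfig (Site 2) × SpinConfig (Site 2) | ∃ α : zdStarGraph.Walk (![-(a : ℤ), 0]) (![(b : ℤ), 0]),
        ∀ z ∈ α.support, p.1 z ≤ p.2 z ∧ ¬ (-(n : ℤ) ≤ z 0 ∧ z 0 ≤ n ∧ z 1 ≤ n)} := by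
    rintro p ⟨-, ⟨w, hw⟩⟩
    exact ⟨w, fun z hz => ⟨by rw [(hw z hz).1]; exact intUnits_le_one _, (hw z hz).2⟩⟩
  calc ENNReal.ofReal (cP * cP) ≤ ENNReal.ofReal ((μ.map θ).real A) := ENNReal.ofReal_le_ofReal key
    _ = (μ.map θ) A := by rw [measureReal_def, ENNReal.ofReal_toReal (measure_ne_top _ _)]
    _ = (μ.prod (μ.map θ)) (Set.univ ×ˢ A) := by rw [Measure.prod_prod, measure_univ, one_mul]
    _ ≤ _ := measure_mono hsub

end Main

end Literature.Probability.LatticeModels
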